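import Literature.NumberTheory.DiophantineGeometry.GenEllProjLine
import Mathlib.NumberTheory.NumberField.InfinitePlace.Ramification
import HarnessLib

/-!
# The functions of [GenEll] §1 on `ℙ¹ ∖ {0,1,∞}` do not depend on the presentation of a point

S. Mochizuki, *Arithmetic elliptic curves in general position*, Math. J. Okayama Univ. 52 (2010)
[cite: MochizukiGenEll2010, Def 1.5 p.8]. In `GenEllProjLine.lean` a point of `X(Q̄)`,
`X = ℙ¹_ℚ`, is PRESENTED as a pair `(F, x)` (`NFPoint`); one Q̄-point has many isomorphic
presentations. [GenEll] p. 4 defines `ht_M̄(x) := deg_F(x_F^* M̄)` "where `x_F : Spec(𝓞_F) → X` is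
any morphism that gives rise to `x`" — i.e. the value does not depend on the presentation; likewise
`log-diff_X`, `log-cond_D` (Def. 1.5) are functions of the point. This file PROVES that for our
representatives: if `e : F ≃+* F'` is a field isomorphism with `e x = x'`, then the presented points
`(F, x)` and `(F', x')` have the same `degree`, `IsMinimal`, `InU`, `ht`, `logDiff`, `logCond`
(`NFPoint.ht_eq_of_ringEquiv`, …).

The one non-formal ingredient is the invariance of Mathlib's number-field height under field
isomorphisms, `mulHeight₁_map_ringEquiv : mulHeight₁ (e x) = mulHeight₁ x` (not in Mathlib, whose
`Height` files list functoriality as TODO). Proof, avoiding valuations: write `x = a/b` with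
`a, b ∈ 𝓞_F`; by `NumberField.mulHeight_eq` and `NumberField.absNorm_mul_finprod_finitePlace_eq_one`
the height of `(a : b)` is `∏_{w ∣ ∞} max(|a|_w,|b|_w)^{mult w} · N(⟨a, b⟩)⁻¹`; the archimedean
factor transports along the bijection `w ↦ w ∘ e` of infinite places (Mathlib
`InfinitePlace.comap`, `isReal_comap_iff`), and `N(⟨e a, e b⟩) = N(⟨a, b⟩)` because `e` induces
`𝓞_F/⟨a,b⟩ ≃ 𝓞_{F'}/⟨e a, e b⟩`. The log-conductor transports through the bad primes of
`(x : 1 − x : 1)` (valuations agree along `HeightOneSpectrum.equivOfRingEquiv`, proved from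
`intValuation_le_pow_iff_mem`) and `N(e·𝔭) = N(𝔭)`; the log-different through Mathlib's
`NumberField.discr_eq_discr_of_algEquiv`.
-/

noncomputable section

open NumberField IsDedekindDomain Height

namespace Literature.NumberTheory.DiophantineGeometry.GenEll

section Transport

variable {K L : Type*} [Field K] [NumberField K] [Field L] [NumberField L]

/-- A ring isomorphism of number fields is a `ℚ`-algebra isomorphism. [folklore] -/
private def ratAlgEquiv (e : K ≃+* L) : K ≃ₐ[ℚ] L :=
  AlgEquiv.ofRingEquiv (f := e) (fun q => by simp)

/-- The absolute norm of an ideal of `𝓞 K` is invariant under the isomorphism `𝓞 K ≃ 𝓞 L` induced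
by a field isomorphism (`𝓞 K ⧸ I ≃ 𝓞 L ⧸ e(I)`). [folklore] -/
private theorem absNorm_map_ringEquiv (E : 𝓞 K ≃+* 𝓞 L) (I : Ideal (𝓞 K)) :
    Ideal.absNorm (I.map E) = Ideal.absNorm I := by
  rw [Ideal.absNorm_apply, Ideal.absNorm_apply, Submodule.cardQuot_apply, Submodule.cardQuot_apply]
  exact Nat.card_congr (Ideal.quotientEquiv I (I.map E) E rfl).toEquiv.symm

/-- The bijection of infinite places `w ↦ w ∘ e` along a field isomorphism `e : K ≃ L`. [folklore] -/
private def infinitePlaceEquiv (e : K ≃+* L) : InfinitePlace L ≃ InfinitePlace K where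
  toFun w := w.comap (e : K →+* L)
  invFun v := v.comap (e.symm : L →+* K)
  left_inv w := Subtype.ext <| AbsoluteValue.ext fun x => by
    change w.1 (e (e.symm x)) = w.1 x
    rw [e.apply_symm_apply]
  right_inv v := Subtype.ext <| AbsoluteValue.ext fun x => by
    change v.1 (e.symm (e x)) = v.1 x
    rw [e.symm_apply_apply]

omit [NumberField K] [NumberField L] in
/-- The bijection `w ↦ w ∘ e` preserves real/complex type, hence the multiplicity. [folklore] -/
private theorem mult_infinitePlaceEquiv (e : K ≃+* L) (w : InfinitePlace L) :
    (infinitePlaceEquiv e w).mult = w.mult := by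
  have h : (infinitePlaceEquiv e w).IsReal ↔ w.IsReal := InfinitePlace.isReal_comap_iff e
  unfold InfinitePlace.mult
  by_cases hw : w.IsReal
  · rw [if_pos hw, if_pos (h.mpr hw)]
  · rw [if_neg hw, if_neg (fun h' => hw (h.mp h'))]

/-- For nonzero `r`, `s` in Dedekind domains and primes `v`, `w` with `r ∈ vⁿ ↔ s ∈ wⁿ` for all `n`,
the adic valuations agree. [folklore] -/
private theorem intValuation_eq_of_forall_mem_pow_iff {R S : Type*} [CommRing R] [IsDedekindDomain R]
    [CommRing S] [IsDedekindDomain S] (v : HeightOneSpectrum R) (w : HeightOneSpectrum S)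
    {r : R} {s : S} (hr : r ≠ 0) (hs : s ≠ 0) (h : ∀ n : ℕ, r ∈ v.asIdeal ^ n ↔ s ∈ w.asIdeal ^ n) :
    v.intValuation r = w.intValuation s := by
  classical
  have key : ∀ n : ℕ, v.intValuation r ≤ WithZero.exp (-(n : ℤ)) ↔
      w.intValuation s ≤ WithZero.exp (-(n : ℤ)) := fun n => by
    rw [HeightOneSpectrum.intValuation_le_pow_iff_mem, HeightOneSpectrum.intValuation_le_pow_iff_mem, h]
  rw [v.intValuation_if_neg hr, w.intValuation_if_neg hs] at key ⊢
  simp only [WithZero.exp_le_exp, neg_le_neg_iff, Int.ofNat_le, WithZero.exp_inj, neg_inj,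
    Nat.cast_inj] at key ⊢
  exact le_antisymm ((key _).mp le_rfl) ((key _).mpr le_rfl)

/-- Valuations agree along the bijection of primes `HeightOneSpectrum.equivOfRingEquiv` induced by
a field isomorphism: `v(x) = (e·v)(e x)`. [folklore] -/
private theorem valuation_equivOfRingEquiv (e : K ≃+* L) (v : HeightOneSpectrum (𝓞 K)) (x : K) :
    (HeightOneSpectrum.equivOfRingEquiv (RingOfIntegers.mapRingEquiv e) v).valuation L (e x) =
      v.valuation K x := by
  set E : 𝓞 K ≃+* 𝓞 L := RingOfIntegers.mapRingEquiv e with hE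
  set w := HeightOneSpectrum.equivOfRingEquiv E v with hw
  have hwI : w.asIdeal = v.asIdeal.map E := by
    rw [hw]
    change v.asIdeal.comap E.symm = _
    exact Ideal.comap_symm E
  -- integers first
  have hint : ∀ r : 𝓞 K, w.valuation L (e (r : K)) = v.valuation K (r : K) := by
    intro r
    have her : e (r : K) = ((E r : 𝓞 L) : L) := by rw [hE]; rfl
    rw [her, HeightOneSpectrum.valuation_of_algebraMap, HeightOneSpectrum.valuation_of_algebraMap]
    rcases eq_or_ne r 0 with rfl | hr
    · simp
    have hs : E r ≠ 0 := by simpa using hr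
    refine intValuation_eq_of_forall_mem_pow_iff w v hs hr fun n => ?_
    rw [hwI, ← Ideal.map_pow, Ideal.apply_mem_of_equiv_iff]
  -- general `x = a / b`
  obtain ⟨a, b, hb, rfl⟩ := IsFractionRing.div_surjective (A := 𝓞 K) x
  have hb0 : (b : K) ≠ 0 := by
    simpa using nonZeroDivisors.ne_zero hb
  rw [map_div₀, map_div₀, map_div₀]
  change w.valuation L (e (a : K)) / w.valuation L (e (b : K)) = _
  rw [hint a, hint b]

/-- **The number-field height is invariant under field isomorphisms** (Galois conjugation):
`H(e x) = H(x)` — Bombieri–Gubler Prop. 1.5.17 "the height is invariant by Galois conjugation",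
here for Mathlib's relative height `mulHeight₁` and any isomorphism `e : K ≃+* L` of number fields.
[cite: BombieriGubler2006, Prop 1.5.17] -/
theorem mulHeight₁_map_ringEquiv (e : K ≃+* L) (x : K) : mulHeight₁ (e x) = mulHeight₁ x := by
  classical
  set E : 𝓞 K ≃+* 𝓞 L := RingOfIntegers.mapRingEquiv e with hE
  obtain ⟨a, b, hb, rfl⟩ := IsFractionRing.div_surjective (A := 𝓞 K) x
  have hb0 : (b : 𝓞 K) ≠ 0 := nonZeroDivisors.ne_zero hb
  have hEb : E b ≠ 0 := by simpa using hb0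
  have hEa : ((E a : 𝓞 L) : L) = e (a : K) := by rw [hE]; rfl
  have hEb' : ((E b : 𝓞 L) : L) = e (b : K) := by rw [hE]; rfl
  -- both sides as heights of pairs of integers
  have hK : mulHeight₁ ((a : K) / (b : K)) = mulHeight ![((a : 𝓞 K) : K), ((b : 𝓞 K) : K)] :=
    mulHeight₁_div_eq_mulHeight _ _
  have hL : mulHeight₁ (e ((a : K) / (b : K))) = mulHeight ![((E a : 𝓞 L) : L), ((E b : 𝓞 L) : L)] := by
    rw [map_div₀, ← hEa, ← hEb', mulHeight₁_div_eq_mulHeight]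
  change mulHeight₁ (e ((a : K) / (b : K))) = mulHeight₁ ((a : K) / (b : K))
  rw [hK, hL]
  -- tuples of integers
  set tK : Fin 2 → 𝓞 K := ![a, b] with htK
  set tL : Fin 2 → 𝓞 L := ![E a, E b] with htL
  have htK0 : tK ≠ 0 := by
    intro h; apply hb0; simpa [htK] using congr_fun h 1
  have htL0 : tL ≠ 0 := by
    intro h; apply hEb; simpa [htL] using congr_fun h 1
  have hcoeK : (fun i => (tK i : K)) = ![((a : 𝓞 K) : K), ((b : 𝓞 K) : K)] := by
    funext i; fin_cases i <;> simp [htK]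
  have hcoeL : (fun i => (tL i : L)) = ![((E a : 𝓞 L) : L), ((E b : 𝓞 L) : L)] := by
    funext i; fin_cases i <;> simp [htL]
  have hK0 : (fun i => (tK i : K)) ≠ 0 := by
    rw [hcoeK]; intro h; apply hb0
    have := congr_fun h 1; simpa using this
  have hL0 : (fun i => (tL i : L)) ≠ 0 := by
    rw [hcoeL]; intro h; apply hEb
    have := congr_fun h 1; simpa using this
  rw [← hcoeK, ← hcoeL, NumberField.mulHeight_eq hK0, NumberField.mulHeight_eq hL0]
  -- finite parts via the absolute norm of the ideal `⟨a, b⟩`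
  have hfinK := NumberField.absNorm_mul_finprod_finitePlace_eq_one htK0
  have hfinL := NumberField.absNorm_mul_finprod_finitePlace_eq_one htL0
  have htLK : tL = E ∘ tK := by
    funext i; fin_cases i <;> rfl
  have hspan : Ideal.span (Set.range tL) = (Ideal.span (Set.range tK)).map E := by
    rw [Ideal.map_span, ← Set.range_comp, ← htLK]
  have hnorm : Ideal.absNorm (Ideal.span (Set.range tL)) = Ideal.absNorm (Ideal.span (Set.range tK)) := by
    rw [hspan, absNorm_map_ringEquiv]
  have hN0 : (Ideal.absNorm (Ideal.span (Set.range tK)) : ℝ) ≠ 0 := by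
    have : Ideal.absNorm (Ideal.span (Set.range tK)) ≠ 0 := by
      rw [ne_eq, Ideal.absNorm_eq_zero_iff, Ideal.span_eq_bot]
      intro h
      exact hb0 (h b ⟨1, by simp [htK]⟩)
    exact_mod_cast this
  have hfin : (∏ᶠ v : FinitePlace L, ⨆ i, v (tL i : L)) = ∏ᶠ v : FinitePlace K, ⨆ i, v (tK i : K) := by
    rw [hnorm] at hfinL
    have h1 : (∏ᶠ v : FinitePlace K, ⨆ i, v (tK i : K)) = (Ideal.absNorm (Ideal.span (Set.range tK)) : ℝ)⁻¹ :=
      eq_inv_of_mul_eq_one_right hfinK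
    have h2 : (∏ᶠ v : FinitePlace L, ⨆ i, v (tL i : L)) = (Ideal.absNorm (Ideal.span (Set.range tK)) : ℝ)⁻¹ :=
      eq_inv_of_mul_eq_one_right hfinL
    rw [h1, h2]
  -- infinite parts via the bijection of infinite places
  have hinf : (∏ w : InfinitePlace L, (⨆ i, w (tL i : L)) ^ w.mult) =
      ∏ v : InfinitePlace K, (⨆ i, v (tK i : K)) ^ v.mult := by
    refine Fintype.prod_equiv (infinitePlaceEquiv e) _ _ fun w => ?_
    rw [mult_infinitePlaceEquiv]
    congr 1
    refine iSup_congr fun i => ?_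
    simp only [infinitePlaceEquiv, Equiv.coe_fn_mk, InfinitePlace.comap_apply]
    congr 1
    fin_cases i
    · simpa [htK, htL] using hEa
    · simpa [htK, htL] using hEb'
  rw [hfin, hinf]

/-- `h(e x) = h(x)` for the logarithmic height (Bombieri–Gubler Prop. 1.5.17).
[cite: BombieriGubler2006, Prop 1.5.17] -/
theorem logHeight₁_map_ringEquiv (e : K ≃+* L) (x : K) : logHeight₁ (e x) = logHeight₁ x := by
  rw [logHeight₁_eq_log_mulHeight₁, logHeight₁_eq_log_mulHeight₁, mulHeight₁_map_ringEquiv]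

/-- The bad primes of a projective point correspond under a field isomorphism.
[folklore] -/
private theorem badPrimes_map_ringEquiv (e : K ≃+* L) (x y z : K) :
    badPrimes (e x) (e y) (e z) =
      HeightOneSpectrum.equivOfRingEquiv (RingOfIntegers.mapRingEquiv e) '' badPrimes x y z := by
  set Φ := HeightOneSpectrum.equivOfRingEquiv (RingOfIntegers.mapRingEquiv e)
  ext w
  constructor
  · intro hw
    refine ⟨Φ.symm w, ?_, Φ.apply_symm_apply w⟩
    simp only [badPrimes, Set.mem_setOf_eq] at hw ⊢
    rwa [← valuation_equivOfRingEquiv e (Φ.symm w) x, ← valuation_equivOfRingEquiv e (Φ.symm w) y,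
      ← valuation_equivOfRingEquiv e (Φ.symm w) z, Φ.apply_symm_apply]
  · rintro ⟨v, hv, rfl⟩
    simp only [badPrimes, Set.mem_setOf_eq] at hv ⊢
    rwa [valuation_equivOfRingEquiv, valuation_equivOfRingEquiv, valuation_equivOfRingEquiv]

/-- Granville–Stark's conductor `N_K(a, b, c) = ∏_{𝔭 ∈ I} N𝔭` (the tree's `radicalNorm`) is
invariant under field isomorphisms (an isomorphism carries the set `I` of bad primes to the set of
bad primes and preserves norms of ideals). [cite: GranvilleStark2000, §1 eq. (1)] -/
theorem radicalNorm_map_ringEquiv (e : K ≃+* L) (x y z : K) :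
    radicalNorm (e x) (e y) (e z) = radicalNorm x y z := by
  set E := RingOfIntegers.mapRingEquiv e
  set Φ := HeightOneSpectrum.equivOfRingEquiv E
  unfold radicalNorm
  rw [badPrimes_map_ringEquiv, finprod_mem_image Φ.injective.injOn]
  refine finprod_mem_congr rfl fun v _ => ?_
  have : (Φ v).asIdeal = v.asIdeal.map E := by
    change v.asIdeal.comap E.symm = _
    exact Ideal.comap_symm E
  rw [this, absNorm_map_ringEquiv]

end Transport

/-! ## Presentation-independence of the [GenEll] §1 functions -/

namespace NFPoint

variable {P Q : NFPoint}

/-- Isomorphic presentations have the same degree `[F:ℚ]`. [cite: MochizukiGenEll2010, Ex 1.3 (i) p.5] -/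
theorem degree_eq_of_ringEquiv (e : P.F ≃+* Q.F) : P.degree = Q.degree :=
  (AlgEquiv.ofRingEquiv (f := e) (fun q => by simp)).toLinearEquiv.finrank_eq

/-- `F` is a minimal field of definition of `x` iff `[ℚ(x):ℚ] = [F:ℚ]`, i.e. iff the minimal
polynomial of `x` has degree `[F:ℚ]`. [cite: MochizukiGenEll2010, Def 1.5 (i) p.8] -/
theorem isMinimal_iff_natDegree (P : NFPoint) : P.IsMinimal ↔ (minpoly ℚ P.x).natDegree = P.degree := by
  have hint : IsIntegral ℚ P.x := Algebra.IsIntegral.isIntegral P.x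
  rw [← IntermediateField.adjoin.finrank hint]
  unfold IsMinimal degree
  constructor
  · intro h
    rw [h]
    exact IntermediateField.finrank_top'
  · intro h
    exact IntermediateField.eq_of_le_of_finrank_eq le_top (h.trans IntermediateField.finrank_top'.symm)

/-- Minimality of the presentation is preserved: `ℚ(x) = F ↔ ℚ(e x) = F'`.
[cite: MochizukiGenEll2010, Def 1.5 (i) p.8] -/
theorem isMinimal_iff_of_ringEquiv (e : P.F ≃+* Q.F) (hx : e P.x = Q.x) : P.IsMinimal ↔ Q.IsMinimal := by
  let f : P.F ≃ₐ[ℚ] Q.F := AlgEquiv.ofRingEquiv (f := e) (fun q => by simp)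
  have hf : f P.x = Q.x := hx
  rw [isMinimal_iff_natDegree, isMinimal_iff_natDegree, ← hf, minpoly.algEquiv_eq f,
    degree_eq_of_ringEquiv e]

/-- Membership in `U_P` is preserved. [cite: MochizukiGenEll2010, Thm 2.1 (ii) p.11] -/
theorem inU_iff_of_ringEquiv (e : P.F ≃+* Q.F) (hx : e P.x = Q.x) : P.InU ↔ Q.InU := by
  simp only [InU, ← hx, ne_eq, map_eq_zero_iff e e.injective, map_eq_one_iff e e.injective]

/-- **The height does not depend on the presentation.** [cite: MochizukiGenEll2010, Def 1.2 (i) p.5] -/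
theorem ht_eq_of_ringEquiv (e : P.F ≃+* Q.F) (hx : e P.x = Q.x) : P.ht = Q.ht := by
  unfold ht
  rw [degree_eq_of_ringEquiv e, ← hx, logHeight₁_map_ringEquiv]

/-- **The log-different does not depend on the presentation.** [cite: MochizukiGenEll2010, Def 1.5 (iii) p.8] -/
theorem logDiff_eq_of_ringEquiv (e : P.F ≃+* Q.F) : P.logDiff = Q.logDiff := by
  rw [logDiff_eq_log_discr, logDiff_eq_log_discr, degree_eq_of_ringEquiv e,
    NumberField.discr_eq_discr_of_algEquiv P.F (AlgEquiv.ofRingEquiv (f := e) (fun q => by simp))]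

/-- **The log-conductor does not depend on the presentation.** [cite: MochizukiGenEll2010, Def 1.5 (iv) p.8] -/
theorem logCond_eq_of_ringEquiv (e : P.F ≃+* Q.F) (hx : e P.x = Q.x) : P.logCond = Q.logCond := by
  rw [logCond_eq, logCond_eq, degree_eq_of_ringEquiv e, ← hx,
    ← radicalNorm_map_ringEquiv e P.x (1 - P.x) 1, map_sub, map_one]

end NFPoint

/-- Membership in `U_P(Q̄)^{≤d}` is preserved under change of presentation.
[cite: MochizukiGenEll2010, Ex 1.3 (i) p.5] -/
theorem mem_UPle_iff_of_ringEquiv {P Q : NFPoint} (e : P.F ≃+* Q.F) (hx : e P.x = Q.x) (d : ℕ) :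
    P ∈ UPle d ↔ Q ∈ UPle d := by
  simp only [UPle, UP, Set.mem_setOf_eq, NFPoint.inU_iff_of_ringEquiv e hx,
    NFPoint.isMinimal_iff_of_ringEquiv e hx, NFPoint.degree_eq_of_ringEquiv e]

end Literature.NumberTheory.DiophantineGeometry.GenEll

end
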